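import Literature.Computability.Complexity.CHFunctions
import HarnessLib

/-!
# Exponential sums of `CH`-graph functions and windows of long numbers

Third toolkit file (theorems only) of the scaled-up `FOM + MAJ` calculus (Bürgisser, ECCC
TR06-113, §3; Hesse–Allender–Barrington, JCSS 65 (2002), §3). Two consequences of exact counting
in `CH` (`cnt_eq_mem_CH`, `CHCounting.lean`):

* **the sum rule** `sumGraph_mem_CH`: if `f` has a `CH` graph and polynomial bit-size then so has
  `x ↦ ∑_{i < 2^{p|x|}} f ⟨x, bin i⟩` — an exponentially long sum of polynomially long numbers is
  ONE witness count, `#{(i, z) | z < f ⟨x, bin i⟩}` (`cnt_add_eq_sum`), which is how iterated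
  addition of short numbers enters the counting hierarchy (Bürgisser 2006, proof of Thm. 3.7(1):
  "`δ(n) = ∑ₖ α(n, k)` is definable in `CH`"; Allender–Wagner 1993, §3);
* **windows of long numbers** `windowGraph_mem_CH`: if the bits of `G x` (a number of possibly
  exponential length) form a `CH` language, then every block `⌊G x / 2^j⌋ mod 2^m` of polynomial
  length `m` (given in unary) is a `CH`-graph function of `⟨x, ⟨bin j, 1^m⟩⟩` — by the sum rule
  applied to `∑_{i<m} 2^i · bit_{j+i}` (`div_two_pow_mod_two_pow_eq_sum`), with the graph of
  `i ↦ 2^i` defined in `CH` from the bit predicate (`pow2Graph_mem_CH`).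

No new definitions.

## References

* P. Bürgisser, ECCC TR06-113 (2006), §3, proof of Thm. 3.7(1).
* E. Allender, K. W. Wagner, *Counting hierarchies: polynomial time and constant depth circuits*
  (1993), §3.
* H. Vollmer, *Introduction to Circuit Complexity* (1999), Thm. 1.20 (iterated addition via
  column counts).
-/

namespace Literature.Computability.Complexity

open _root_.Computability Polynomial PRelSigma TTClosure Brick PPSharpP ThresholdPP

/-! ### Counting lemmas -/

/-- Exactly `θ` strings of length `b` have value `< θ` (for `θ ≤ 2^b`). [folklore] -/
theorem cnt_val_lt {b θ : ℕ} (h : θ ≤ 2 ^ b) : cnt b {y : List Bool | bitsToNat y < θ} = θ := by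
  have h1 := cnt_add_cnt_compl b {y : List Bool | bitsToNat y < θ}
  have h2 : ({y : List Bool | bitsToNat y < θ}ᶜ : Set (List Bool)) = {y | θ ≤ bitsToNat y} := by
    ext y; simp
  rw [h2, ThresholdPP.cnt_ge] at h1
  omega

/-- Splitting a sum over `range (2n)` by parity. [folklore] -/
theorem sum_range_two_mul_eq (g : ℕ → ℕ) (n : ℕ) :
    ∑ i ∈ Finset.range (2 * n), g i = ∑ i ∈ Finset.range n, g (2 * i) + ∑ i ∈ Finset.range n, g (2 * i + 1) := by
  induction n with
  | zero => simp
  | succ n ih =>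
    rw [show 2 * (n + 1) = 2 * n + 1 + 1 by ring, Finset.sum_range_succ, Finset.sum_range_succ, ih,
      Finset.sum_range_succ, Finset.sum_range_succ]
    ring

/-- **Product counting**: among the strings `y = u ++ v` of length `a + b` (`|u| = a`), those with
`val v < F (val u)` are `∑_{i < 2^a} F i` many, provided `F i ≤ 2^b` on `i < 2^a`. [folklore] -/
theorem cnt_add_eq_sum : ∀ (a b : ℕ) (F : ℕ → ℕ), (∀ i < 2 ^ a, F i ≤ 2 ^ b) →
    cnt (a + b) {y : List Bool | bitsToNat (y.drop a) < F (bitsToNat (y.take a))} =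
      ∑ i ∈ Finset.range (2 ^ a), F i
  | 0, b, F, hF => by
    simp only [List.drop_zero, List.take_zero, bitsToNat_nil, zero_add, pow_zero, Finset.range_one,
      Finset.sum_singleton]
    exact cnt_val_lt (hF 0 (by norm_num))
  | a + 1, b, F, hF => by
    rw [show a + 1 + b = (a + b) + 1 by ring, cnt_succ]
    have h0 : {y : List Bool | false :: y ∈ {y : List Bool | bitsToNat (y.drop (a + 1)) < F (bitsToNat (y.take (a + 1)))}} =
        {y | bitsToNat (y.drop a) < F (2 * bitsToNat (y.take a))} := by
      ext y; simp
    have h1 : {y : List Bool | true :: y ∈ {y : List Bool | bitsToNat (y.drop (a + 1)) < F (bitsToNat (y.take (a + 1)))}} =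
        {y | bitsToNat (y.drop a) < F (2 * bitsToNat (y.take a) + 1)} := by
      ext y; simp [add_comm]
    rw [h0, h1, cnt_add_eq_sum a b (fun i => F (2 * i)) fun i hi => hF _ (by rw [pow_succ]; omega),
      cnt_add_eq_sum a b (fun i => F (2 * i + 1)) fun i hi => hF _ (by rw [pow_succ]; omega),
      pow_succ, mul_comm, sum_range_two_mul_eq]

/-! ### The sum rule -/

section SumRule

variable {f : List Bool → ℕ} {q : Polynomial ℕ}

/-- Length of the summation index word: `|⟨x, bin i⟩| ≤ 2|x| + 2 + p(|x|)` for `i < 2^{p|x|}`. [folklore] -/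
theorem length_boolPair_encodeNat_le (p : Polynomial ℕ) (x : List Bool) {i : ℕ} (hi : i < 2 ^ p.eval x.length) :
    (boolPair x (encodeNat i)).length ≤ (2 * X + 2 + p).eval x.length := by
  rw [length_boolPair]
  have := (Brick.length_encodeNat_le_iff i _).2 hi
  simp; omega

/-- **Bit-size of the exponential sum**: `∑_{i<2^{p|x|}} f ⟨x, bin i⟩ < 2^{(p + q(2X+2+p))(|x|)}`. [folklore] -/
theorem sum_lt_two_pow (hb : ∀ w, f w < 2 ^ q.eval w.length) (p : Polynomial ℕ) (x : List Bool) :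
    ∑ i ∈ Finset.range (2 ^ p.eval x.length), f (boolPair x (encodeNat i)) <
      2 ^ (p + q.comp (2 * X + 2 + p)).eval x.length := by
  have hterm : ∀ i ∈ Finset.range (2 ^ p.eval x.length),
      f (boolPair x (encodeNat i)) ≤ 2 ^ (q.comp (2 * X + 2 + p)).eval x.length := fun i hi => by
    refine (hb _).le.trans (Nat.pow_le_pow_right (by norm_num) ?_)
    rw [eval_comp]
    exact TM2Iter.eval_mono q (length_boolPair_encodeNat_le p x (Finset.mem_range.1 hi))
  have h0 : f (boolPair x (encodeNat 0)) < 2 ^ (q.comp (2 * X + 2 + p)).eval x.length := by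
    refine (hb _).trans_le (Nat.pow_le_pow_right (by norm_num) ?_)
    rw [eval_comp]
    exact TM2Iter.eval_mono q (length_boolPair_encodeNat_le p x (Nat.two_pow_pos _))
  have hsum : ∑ i ∈ Finset.range (2 ^ p.eval x.length), f (boolPair x (encodeNat i)) <
      ∑ _i ∈ Finset.range (2 ^ p.eval x.length), 2 ^ (q.comp (2 * X + 2 + p)).eval x.length :=
    Finset.sum_lt_sum hterm ⟨0, Finset.mem_range.2 (Nat.two_pow_pos _), h0⟩
  simp only [Finset.sum_const, Finset.card_range, smul_eq_mul] at hsum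
  rwa [eval_add, pow_add]

/-- **The sum rule** (iterated addition of short numbers as one count). If `f` has a `CH` graph
and `f w < 2^{q|w|}`, then `x ↦ ∑_{i < 2^{p|x|}} f ⟨x, bin i⟩` has a `CH` graph: the sum equals
`#{y ∈ {0,1}^{p|x| + Q|x|} | val (y ⇂ p|x|) < f ⟨x, bin (val (y ↾ p|x|))⟩}` (`cnt_add_eq_sum`),
a witness count of a `CH` language (Bürgisser 2006, proof of Thm. 3.7(1); Allender–Wagner 1993,
§3). [cite: Burgisser2006, Theorem 3.7] -/
theorem sumGraph_mem_CH (hf : {z | f (fstP z) = bitsToNat (sndP z)} ∈ CH)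
    (hb : ∀ w, f w < 2 ^ q.eval w.length) (p : Polynomial ℕ) :
    {z | (∑ i ∈ Finset.range (2 ^ p.eval (fstP z).length), f (boolPair (fstP z) (encodeNat i))) =
      bitsToNat (sndP z)} ∈ CH := by
  -- the witness language `W = {⟨x, y⟩ | val (y ⇂ p|x|) < f ⟨x, norm (y ↾ p|x|)⟩}`
  have hh : pairFn (pairFn fstP (norm ∘ sndP ∘ truncSndFn p)) (sndP ∘ dropSndFn p) ∈ FP :=
    pairFn_mem_FP (pairFn_mem_FP fstP_mem_FP (comp_mem_FP norm_mem_FP (comp_mem_FP sndP_mem_FP (truncSndFn_mem_FP p))))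
      (comp_mem_FP sndP_mem_FP (dropSndFn_mem_FP p))
  have hW := preimage_mem_CH (gtGraph_mem_CH hf hb) hh
  refine mem_CH_of_iff (cnt_eq_mem_CH (p + q.comp (2 * X + 2 + p)) hW) _ fun z => ?_
  change _ ↔ cnt ((p + q.comp (2 * X + 2 + p)).eval (fstP z).length)
      {y | boolPair (fstP z) y ∈ pairFn (pairFn fstP (norm ∘ sndP ∘ truncSndFn p)) (sndP ∘ dropSndFn p) ⁻¹'
        {z | bitsToNat (sndP z) < f (fstP z)}} = bitsToNat (sndP z)
  have hset : {y | boolPair (fstP z) y ∈ pairFn (pairFn fstP (norm ∘ sndP ∘ truncSndFn p)) (sndP ∘ dropSndFn p) ⁻¹'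
        {z | bitsToNat (sndP z) < f (fstP z)}} =
      {y : List Bool | bitsToNat (y.drop (p.eval (fstP z).length)) <
        (fun i => f (boolPair (fstP z) (encodeNat i))) (bitsToNat (y.take (p.eval (fstP z).length)))} := by
    ext y
    change bitsToNat (sndP (pairFn (pairFn fstP (norm ∘ sndP ∘ truncSndFn p)) (sndP ∘ dropSndFn p) (boolPair (fstP z) y))) <
        f (fstP (pairFn (pairFn fstP (norm ∘ sndP ∘ truncSndFn p)) (sndP ∘ dropSndFn p) (boolPair (fstP z) y))) ↔
      bitsToNat (y.drop (p.eval (fstP z).length)) <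
        f (boolPair (fstP z) (encodeNat (bitsToNat (y.take (p.eval (fstP z).length)))))
    simp only [pairFn_apply, Function.comp_apply, truncSndFn_boolPair, dropSndFn_boolPair, sndP_boolPair,
      fstP_boolPair, norm_eq_encodeNat]
  rw [hset, eval_add, cnt_add_eq_sum _ _ (fun i => f (boolPair (fstP z) (encodeNat i)))]
  · rfl
  · intro i hi
    refine (hb _).le.trans (Nat.pow_le_pow_right (by norm_num) ?_)
    rw [eval_comp]
    exact TM2Iter.eval_mono q (length_boolPair_encodeNat_le p _ hi)

end SumRule

/-! ### The graph of `i ↦ 2^i` -/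

/-- `2^i` is the number whose only set bit is bit `i`. [folklore] -/
theorem eq_two_pow_iff_testBit (v i : ℕ) :
    v = 2 ^ i ↔ v.testBit i = true ∧ ∀ k, k ≠ i → v.testBit k = false := by
  constructor
  · rintro rfl
    exact ⟨Nat.testBit_two_pow_self, fun k hk => Nat.testBit_two_pow_of_ne (Ne.symm hk)⟩
  · rintro ⟨h1, h2⟩
    apply Nat.eq_of_testBit_eq
    intro k
    by_cases hk : k = i
    · subst hk; rw [h1, Nat.testBit_two_pow_self]
    · rw [h2 k hk, Nat.testBit_two_pow_of_ne (Ne.symm hk)]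

/-- **The graph of `i ↦ 2^i` is in `CH`**: `{⟨i, ν⟩ | 2^{val i} = val ν}` — bit `val i` of `val ν`
is set and every other bit below `2^{|w|}` (which covers all of `ν`) is clear, a `∀` over a `P`
predicate. [folklore] -/
theorem pow2Graph_mem_CH : {u | 2 ^ bitsToNat (fstP u) = bitsToNat (sndP u)} ∈ CH := by
  -- `A = {⟨i, ν⟩ | bit (val i) of val ν}`, `D = {⟨⟨i, ν⟩, k⟩ | val k = val i ∨ ¬ bit (val k) of val ν}`
  have hA : (pairFn sndP fstP ⁻¹' ({w | (bitsToNat (fstP w)).testBit (bitsToNat (sndP w)) = true} : Language Bool)) ∈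
      Classes.P := preimage_mem_P testBitLang_mem_P (pairFn_mem_FP sndP_mem_FP fstP_mem_FP)
  have hD : (pairFn sndP (fstP ∘ fstP) ⁻¹' ({u | bitsToNat (fstP u) = bitsToNat (sndP u)} : Language Bool)) ⊔
      (pairFn (sndP ∘ fstP) sndP ⁻¹' ({w | (bitsToNat (fstP w)).testBit (bitsToNat (sndP w)) = true} : Language Bool))ᶜ ∈
      Classes.P :=
    union_mem_P (preimage_mem_P eqVal_mem_P (pairFn_mem_FP sndP_mem_FP (comp_mem_FP fstP_mem_FP fstP_mem_FP)))
      ((compl_mem_P_iff).2 (preimage_mem_P testBitLang_mem_P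
        (pairFn_mem_FP (comp_mem_FP sndP_mem_FP fstP_mem_FP) sndP_mem_FP)))
  have hB := forall_lt_mem_CH (P_subset_CH hD) X
  refine mem_CH_of_iff (inter_P_mem_CH hA hB) _ fun u => ?_
  rw [memL_inf']
  change 2 ^ bitsToNat (fstP u) = bitsToNat (sndP u) ↔
    (bitsToNat (fstP (pairFn sndP fstP u))).testBit (bitsToNat (sndP (pairFn sndP fstP u))) = true ∧
    ∀ v < 2 ^ (X : Polynomial ℕ).eval u.length,
    bitsToNat (fstP (pairFn sndP (fstP ∘ fstP) (boolPair u (encodeNat v)))) =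
        bitsToNat (sndP (pairFn sndP (fstP ∘ fstP) (boolPair u (encodeNat v)))) ∨
      ¬ (bitsToNat (fstP (pairFn (sndP ∘ fstP) sndP (boolPair u (encodeNat v))))).testBit
          (bitsToNat (sndP (pairFn (sndP ∘ fstP) sndP (boolPair u (encodeNat v))))) = true
  simp only [pairFn_apply, Function.comp_apply, fstP_boolPair, sndP_boolPair, bitsToNat_encodeNat, eval_X,
    Bool.not_eq_true]
  rw [eq_comm, eq_two_pow_iff_testBit]
  have hlen : (sndP u).length ≤ u.length := by
    have := length_fstF_sndF_le u; change 2 * (fstP u).length + (sndP u).length ≤ _ at this; omega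
  constructor
  · rintro ⟨h1, h2⟩
    exact ⟨h1, fun v _ => (em (v = bitsToNat (fstP u))).imp_right (h2 v)⟩
  · rintro ⟨h1, h2⟩
    refine ⟨h1, fun k hk => ?_⟩
    by_cases hlt : k < 2 ^ u.length
    · exact (h2 k hlt).resolve_left hk
    · apply Nat.testBit_eq_false_of_lt
      have h2k : u.length < 2 ^ u.length := Nat.lt_two_pow_self
      exact (bitsToNat_lt _).trans_le (Nat.pow_le_pow_right (by norm_num) (hlen.trans (by omega)))

/-! ### Windows of long numbers -/

/-- `n mod 2^m = ∑_{i<m} 2^i · bit_i(n)`. [folklore] -/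
theorem mod_two_pow_eq_sum_testBit (n : ℕ) : ∀ m : ℕ,
    n % 2 ^ m = ∑ i ∈ Finset.range m, 2 ^ i * (n.testBit i).toNat
  | 0 => by simp [Nat.mod_one]
  | m + 1 => by
    rw [Nat.mod_pow_succ, mod_two_pow_eq_sum_testBit n m, Finset.sum_range_succ, Nat.toNat_testBit]

/-- The window `⌊N / 2^j⌋ mod 2^m` as the sum of its bits: `∑_{i<m} 2^i · bit_{j+i}(N)`. [folklore] -/
theorem div_two_pow_mod_two_pow_eq_sum (N j m : ℕ) :
    N / 2 ^ j % 2 ^ m = ∑ i ∈ Finset.range m, 2 ^ i * (N.testBit (j + i)).toNat := by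
  rw [mod_two_pow_eq_sum_testBit]
  refine Finset.sum_congr rfl fun i _ => ?_
  rw [Nat.testBit_div_two_pow, add_comm]

section Window

variable {G : List Bool → ℕ}

/-- Definition by cases, predicate form of `iteGraph_mem_CH`. [cite: Toran1991, §4] -/
theorem iteGraph_mem_CH' {Q : List Bool → Prop} [DecidablePred Q] (hC : ({w | Q w} : Language Bool) ∈ CH)
    {f g : List Bool → ℕ} (hf : {z | f (fstP z) = bitsToNat (sndP z)} ∈ CH)
    (hg : {z | g (fstP z) = bitsToNat (sndP z)} ∈ CH) :
    {z | (if Q (fstP z) then f (fstP z) else g (fstP z)) = bitsToNat (sndP z)} ∈ CH := by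
  have hC' : fstP ⁻¹' ({w | Q w} : Language Bool) ∈ CH := preimage_mem_CH hC fstP_mem_FP
  refine mem_CH_of_iff (union_mem_CH (inter_mem_CH hC' hf) (inter_mem_CH (compl_mem_CH hC') hg)) _ fun z => ?_
  rw [memL_sup, memL_inf', memL_inf', memL_compl]
  change (if Q (fstP z) then f (fstP z) else g (fstP z)) = bitsToNat (sndP z) ↔
    (Q (fstP z) ∧ f (fstP z) = bitsToNat (sndP z)) ∨ (¬ Q (fstP z) ∧ g (fstP z) = bitsToNat (sndP z))
  by_cases h : Q (fstP z)
  · rw [if_pos h]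
    simp only [h, true_and, not_true_eq_false, false_and, or_false]
  · rw [if_neg h]
    simp only [h, false_and, not_false_eq_true, true_and, false_or]

/-- **Comparing a value with a length is in `P`**: `{⟨r, ν⟩ | val ν < |r|}` (unary conversion capped
at `|r|`, then a length test). [folklore] -/
theorem valLtLen_mem_P : ({u | bitsToNat (sndP u) < (fstP u).length} : Language Bool) ∈ Classes.P := by
  refine mem_P_of_iff ((compl_mem_P_iff).2 (preimage_mem_P (LenLe_mem_P X)
    (pairFn_mem_FP (comp_mem_FP binToUnaryFn_mem_FP (pairFn_mem_FP fstP_mem_FP sndP_mem_FP)) fstP_mem_FP))) _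
    fun u => ?_
  rw [memL_compl]
  change _ ↔ ¬ pairFn (binToUnaryFn ∘ pairFn fstP sndP) fstP u ∈ LenLe X
  rw [pairFn_apply, boolPair_mem_LenLe, eval_X, Function.comp_apply, pairFn_apply, binToUnaryFn_boolPair]
  change bitsToNat (sndP u) < (fstP u).length ↔ _
  simp only [List.length_replicate, not_le]
  omega

/-- The window summand on `w = ⟨u, bin i⟩`, `u = ⟨x, ⟨j, r⟩⟩`: `2^i` if `i < |r|` and bit
`val j + i` of `G x` is set, else `0`. Its graph is in `CH` when the bits of `G` are. [folklore] -/
theorem windowTermGraph_mem_CH (hG : {z | (G (fstP z)).testBit (bitsToNat (sndP z)) = true} ∈ CH) :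
    {z | (if bitsToNat (sndP (fstP z)) < (sndP (sndP (fstP (fstP z)))).length ∧
          (G (fstP (fstP (fstP z)))).testBit (bitsToNat (fstP (sndP (fstP (fstP z)))) + bitsToNat (sndP (fstP z))) = true
        then 2 ^ bitsToNat (sndP (fstP z)) else 0) = bitsToNat (sndP z)} ∈ CH := by
  -- the condition `Q w` for `w = ⟨u, bin i⟩`
  have hA : ({w | bitsToNat (sndP w) < (sndP (sndP (fstP w))).length} : Language Bool) ∈ Classes.P :=
    mem_P_of_iff (preimage_mem_P valLtLen_mem_P (pairFn_mem_FP (comp_mem_FP sndP_mem_FP (comp_mem_FP sndP_mem_FP fstP_mem_FP))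
      sndP_mem_FP)) _ fun w => by
        change _ ↔ bitsToNat (sndP (pairFn (sndP ∘ sndP ∘ fstP) sndP w)) < (fstP (pairFn (sndP ∘ sndP ∘ fstP) sndP w)).length
        rw [pairFn_apply, fstP_boolPair, sndP_boolPair]; rfl
  have hB : {w | (G (fstP (fstP w))).testBit (bitsToNat (fstP (sndP (fstP w))) + bitsToNat (sndP w)) = true} ∈ CH :=
    mem_CH_of_iff (preimage_mem_CH hG (pairFn_mem_FP (comp_mem_FP fstP_mem_FP fstP_mem_FP)
      (comp_mem_FP addFn_mem_FP (pairFn_mem_FP (comp_mem_FP fstP_mem_FP (comp_mem_FP sndP_mem_FP fstP_mem_FP))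
        sndP_mem_FP)))) _ fun w => by
        change _ ↔ (G (fstP (pairFn (fstP ∘ fstP) (addFn ∘ pairFn (fstP ∘ sndP ∘ fstP) sndP) w))).testBit
          (bitsToNat (sndP (pairFn (fstP ∘ fstP) (addFn ∘ pairFn (fstP ∘ sndP ∘ fstP) sndP) w))) = true
        simp only [pairFn_apply, Function.comp_apply, fstP_boolPair, sndP_boolPair, addFn_boolPair, bitsToNat_encodeNat]
        rfl
  have hC : ({w | bitsToNat (sndP w) < (sndP (sndP (fstP w))).length ∧
      (G (fstP (fstP w))).testBit (bitsToNat (fstP (sndP (fstP w))) + bitsToNat (sndP w)) = true} : Language Bool) ∈ CH :=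
    mem_CH_of_iff (inter_P_mem_CH hA hB) _ fun w => by rw [memL_inf']; rfl
  have hthen : {z | 2 ^ bitsToNat (sndP (fstP z)) = bitsToNat (sndP z)} ∈ CH :=
    mem_CH_of_iff (preimage_mem_CH pow2Graph_mem_CH (pairFn_mem_FP (comp_mem_FP sndP_mem_FP fstP_mem_FP) sndP_mem_FP))
      _ fun z => by
        change _ ↔ 2 ^ bitsToNat (fstP (pairFn (sndP ∘ fstP) sndP z)) = bitsToNat (sndP (pairFn (sndP ∘ fstP) sndP z))
        rw [pairFn_apply, fstP_boolPair, sndP_boolPair]; rfl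
  have hzero : {z | (fun _ : List Bool => (0 : ℕ)) (fstP z) = bitsToNat (sndP z)} ∈ CH :=
    mem_CH_of_iff (P_subset_CH (preimage_mem_P valZero_mem_P sndP_mem_FP)) _ fun z => by
      change (0 : ℕ) = bitsToNat (sndP z) ↔ bitsToNat (sndP z) = 0
      exact eq_comm
  exact iteGraph_mem_CH' hC (f := fun w => 2 ^ bitsToNat (sndP w)) (g := fun _ => 0) hthen hzero

/-- Semantics of the window summand on a well-formed index word. [folklore] -/
theorem windowTerm_apply (u : List Bool) (i : ℕ) :
    (if bitsToNat (sndP (boolPair u (encodeNat i))) < (sndP (sndP (fstP (boolPair u (encodeNat i))))).length ∧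
          (G (fstP (fstP (boolPair u (encodeNat i))))).testBit
            (bitsToNat (fstP (sndP (fstP (boolPair u (encodeNat i))))) + bitsToNat (sndP (boolPair u (encodeNat i)))) = true
        then 2 ^ bitsToNat (sndP (boolPair u (encodeNat i))) else 0) =
      if i < (sndP (sndP u)).length then 2 ^ i * ((G (fstP u)).testBit (bitsToNat (fstP (sndP u)) + i)).toNat else 0 := by
  simp only [fstP_boolPair, sndP_boolPair, bitsToNat_encodeNat]
  by_cases hi : i < (sndP (sndP u)).length
  · by_cases hb : (G (fstP u)).testBit (bitsToNat (fstP (sndP u)) + i) = true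
    · rw [if_pos ⟨hi, hb⟩, if_pos hi, hb]; simp
    · rw [if_neg (fun h => hb h.2), if_pos hi, Bool.eq_false_iff.2 hb]; simp
  · rw [if_neg (fun h => hi h.1), if_neg hi]

/-- Lengths of the components of `u = ⟨x, ⟨j, r⟩⟩`: `|j| + |r| ≤ |u|`. [folklore] -/
theorem length_components_le (u : List Bool) : (fstP (sndP u)).length + (sndP (sndP u)).length ≤ u.length := by
  have a := length_fstF_sndF_le u
  have b := length_fstF_sndF_le (sndP u)
  change 2 * (fstP u).length + (sndP u).length ≤ _ at a
  change 2 * (fstP (sndP u)).length + (sndP (sndP u)).length ≤ _ at b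
  omega

/-- **Windows of a long number are `CH`-graph functions.** If the bit language
`{⟨x, j⟩ | bit (val j) of G x}` is in `CH`, then on words `u = ⟨x, ⟨j, r⟩⟩` the block
`⌊G x / 2^{val j}⌋ mod 2^{|r|}` (window of length `|r|`, given in unary, at position `val j`) has a
`CH` graph: it is `∑_{i<|r|} 2^i · bit_{val j + i}(G x)`, an instance of the sum rule. This is the
read-out of polynomially many consecutive bits used throughout the Chinese-remainder
computations of Hesse–Allender–Barrington (2002, §4) scaled up to `CH` (Bürgisser 2006, §3). [cite: Burgisser2006, Theorem 3.7] -/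
theorem windowGraph_mem_CH (hG : {z | (G (fstP z)).testBit (bitsToNat (sndP z)) = true} ∈ CH) :
    {z | G (fstP (fstP z)) / 2 ^ bitsToNat (fstP (sndP (fstP z))) % 2 ^ (sndP (sndP (fstP z))).length =
      bitsToNat (sndP z)} ∈ CH := by
  have hb : ∀ w, (if bitsToNat (sndP w) < (sndP (sndP (fstP w))).length ∧
          (G (fstP (fstP w))).testBit (bitsToNat (fstP (sndP (fstP w))) + bitsToNat (sndP w)) = true
        then 2 ^ bitsToNat (sndP w) else 0) < 2 ^ (X : Polynomial ℕ).eval w.length := by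
    intro w
    rw [eval_X]
    split_ifs with h
    · refine Nat.pow_lt_pow_right (by norm_num) (h.1.trans_le ?_)
      exact ((Nat.le_add_left _ _).trans (length_components_le (fstP w))).trans (length_fstP_le w)
    · exact Nat.two_pow_pos _
  refine mem_CH_of_iff (sumGraph_mem_CH (windowTermGraph_mem_CH hG) hb X) _ fun z => ?_
  change _ ↔ (∑ i ∈ Finset.range (2 ^ (X : Polynomial ℕ).eval (fstP z).length), _) = bitsToNat (sndP z)
  simp only [windowTerm_apply, eval_X]
  rw [← Finset.sum_filter]
  have hrange : (Finset.range (2 ^ (fstP z).length)).filter (fun i => i < (sndP (sndP (fstP z))).length) =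
      Finset.range (sndP (sndP (fstP z))).length := by
    ext i
    simp only [Finset.mem_filter, Finset.mem_range]
    have hle : (sndP (sndP (fstP z))).length ≤ (fstP z).length :=
      (Nat.le_add_left _ _).trans (length_components_le (fstP z))
    have hlt : (fstP z).length < 2 ^ (fstP z).length := Nat.lt_two_pow_self
    omega
  rw [hrange, ← div_two_pow_mod_two_pow_eq_sum]
  rfl

/-- **Bit-size of a window**: `⌊G x / 2^{val j}⌋ mod 2^{|r|} < 2^{|u|}` for `u = ⟨x, ⟨j, r⟩⟩`. [folklore] -/
theorem window_lt_two_pow (G : List Bool → ℕ) (u : List Bool) :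
    G (fstP u) / 2 ^ bitsToNat (fstP (sndP u)) % 2 ^ (sndP (sndP u)).length < 2 ^ (X : Polynomial ℕ).eval u.length := by
  rw [eval_X]
  exact (Nat.mod_lt _ (Nat.two_pow_pos _)).trans_le
    (Nat.pow_le_pow_right (by norm_num) ((Nat.le_add_left _ _).trans (length_components_le u)))

end Window

end Literature.Computability.Complexity
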